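import Mathlib
import Literature.Analysis.FluidPDE.Tao2016AveragedNS.ShiftSetCascadeFlows
import Literature.Analysis.FluidPDE.Tao2016AveragedNS.ShiftSetCascadeFlux
import Summits.NavierStokesRegularity.NavierStokesRegularity.Theorems.TaoLadderRungTwoFlatQuadPolarOn
import Summits.NavierStokesRegularity.NavierStokesRegularity.Theorems.TaoLadderRungTwoFlatLinearisedUniqueness
import Summits.NavierStokesRegularity.NavierStokesRegularity.Theorems.TaoLadderRungTwoFlatLinearisedGronwall
import Summits.NavierStokesRegularity.NavierStokesRegularity.Theorems.TaoLadderRungTwoFlatFlowContinuity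
import Summits.NavierStokesRegularity.NavierStokesRegularity.Theorems.TaoLadderRungTwoFlatHomogeneousL2Field
import Summits.NavierStokesRegularity.NavierStokesRegularity.Theorems.TaoLadderRungTwoFlatGaugeGronwall
import HarnessLib

/-!
# Gauge Duhamel–Gronwall ON A TIME WINDOW `[0, T]` (one-sided data: continuity on `Icc 0 T`, derivatives on `Ioo 0 T`),
  and the bridge from EXACT `PseudoFlowOnShift` flows — the form consumable by certificate windows
  (helper for item stmt-NavierStokesRegularity-22987 `FlatGapCertificatesV2`, crux K_A♭ of route TaoLadderRungTwoFlat;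
  cell harvest/h2-tao-ladder, p1 g20 — closes the integration gap noted in REPORT-p1g20 §2: the graded lattice has no
  global solutions, its flows come as `TaoCascade.PseudoFlowOnShift` on windows)

`…GaugeGronwall` assumes solutions at all times (`∀ t, HasDerivAt …`). Here the same Picard argument runs with the
hypotheses a window flow actually provides: `ContinuousOn (u i n) (Icc 0 T)` and `HasDerivAt` on `Ioo 0 T`
(`intervalIntegral.integral_eq_sub_of_hasDerivAt_of_le`), background and forcing continuous and bounded on `[0, T]`:

* `continuousOn_linTermOn`; `gauge_abs_le_forced_majorant_Icc`, **`gauge_abs_le_forced_exp_Icc`**,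
  `gauge_abs_le_exp_Icc`, **`gauge_abs_sub_le_Icc`** — window versions of the gauge Gronwall bounds;
* `hasDerivAt_of_pseudoFlowOnShift_exact`, `continuousOn_of_pseudoFlowOnShift` — an exact (`κ₁ = 0`) `PseudoFlowOnShift`
  flow on `[0, τ]` solves `Ṡ = quadTermOn 𝕊 ε₀ α S` with `HasDerivAt` at every interior time and is continuous on the
  window (so, after the renormalised frame `RenormFrame.clockW_mul_quadTermOn`, the window lemmas apply to graded flows).

HONEST FRAMING: elementary real analysis for MODEL lattices; nothing certified; nothing about the Navier–Stokes equations.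
-/

noncomputable section

-- the sub-problem namespace repeats the summit name by design (D-0017)
set_option linter.dupNamespace false

namespace Summit.NavierStokesRegularity.NavierStokesRegularity.Theorems

open Set Filter Literature.Analysis.FluidPDE Literature.Analysis.FluidPDE.TaoCascade
open scoped Topology Nat

namespace QuadPolar

variable {m : ℕ}

/-- The linearisation of families continuous on a set is continuous there. [cite: Tao2016AveragedNS, §4 (4.8)] -/
theorem continuousOn_linTermOn (𝕊 : Finset (ℤ × ℤ × ℤ)) (ε₀ : ℝ)
    (α : Fin m → Fin m → Fin m → ℤ × ℤ × ℤ → ℝ) {Φ u : Fin m → ℤ → ℝ → ℝ} {I : Set ℝ}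
    (hΦ : ∀ j k, ContinuousOn (Φ j k) I) (hu : ∀ j k, ContinuousOn (u j k) I) (i : Fin m) (n : ℤ) :
    ContinuousOn (fun t => linTermOn 𝕊 ε₀ α Φ u i n t) I := by
  unfold linTermOn bilinOn
  refine ContinuousOn.add ?_ ?_ <;>
    refine continuousOn_finsetSum _ fun i₁ _ => continuousOn_finsetSum _ fun i₂ _ =>
      continuousOn_finsetSum _ fun μ _ => ?_
  · exact continuousOn_const.mul ((hΦ _ _).mul (hu _ _))
  · exact continuousOn_const.mul ((hu _ _).mul (hΦ _ _))

/-! ### Picard majorants on a window -/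

/-- **Site-wise Picard majorants with forcing on `[0, T]`** (window data): `u̇ = Lin_Φ(u) + f` on `Ioo 0 T`, `u`, `Φ`, `f`
continuous on `Icc 0 T`, `w|f| ≤ F`, `|Φ| ≤ M_Φ`, `|u| ≤ M_u` on `[0, T]`, `w|u(0)| ≤ B`, gauge window-regular (`Λ`),
shift set nearest-neighbour: `|u_{i,n}(s)| ≤ (B/w_{i,n} + (F/w_{i,n})s)·Σ_{l<j}(L's)^l/l! + M_u (L's)^j/j!`, `L' = 2‖α‖₁M_ΦΛ`.
[cite: Tao2016AveragedNS, §4 (4.8); folklore (Picard iteration)] -/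
theorem gauge_abs_le_forced_majorant_Icc {𝕊 : Finset (ℤ × ℤ × ℤ)} (h𝕊 : IsNearestNeighbourSet 𝕊)
    (α : Fin m → Fin m → Fin m → ℤ × ℤ × ℤ → ℝ) {w : Fin m → ℤ → ℝ} {Λ : ℝ} (hw : IsWindowRegular w Λ)
    {Φ u f : Fin m → ℤ → ℝ → ℝ} {MΦ Mu B F T : ℝ} (hΦc : ∀ j k, ContinuousOn (Φ j k) (Icc 0 T))
    (hΦ : ∀ j k, ∀ t ∈ Icc 0 T, |Φ j k t| ≤ MΦ) (hfc : ∀ j k, ContinuousOn (f j k) (Icc 0 T))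
    (hf : ∀ j k, ∀ t ∈ Icc 0 T, w j k * |f j k t| ≤ F) (hF : 0 ≤ F) (huc : ∀ i n, ContinuousOn (u i n) (Icc 0 T))
    (hder : ∀ i n, ∀ t ∈ Ioo 0 T, HasDerivAt (u i n) (linTermOn 𝕊 0 α Φ u i n t + f i n t) t)
    (hbdd : ∀ i n, ∀ t ∈ Icc 0 T, |u i n t| ≤ Mu) (hB : ∀ i n, w i n * |u i n 0| ≤ B) :
    ∀ (j : ℕ) (i : Fin m) (n : ℤ), ∀ s ∈ Icc 0 T,
      |u i n s| ≤ (B / w i n + F / w i n * s) *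
          ∑ l ∈ Finset.range j, (2 * tableAbsSum 𝕊 α * MΦ * Λ * s) ^ l / l ! +
        Mu * (2 * tableAbsSum 𝕊 α * MΦ * Λ * s) ^ j / j ! := by
  have hpos := hw.1
  have hΛ := hw.2.1
  set L := 2 * tableAbsSum 𝕊 α * MΦ * Λ with hL
  have hLc : ∀ i n, ContinuousOn (fun t => linTermOn 𝕊 0 α Φ u i n t + f i n t) (Icc 0 T) :=
    fun i n => (continuousOn_linTermOn 𝕊 0 α hΦc huc i n).add (hfc i n)
  intro j
  induction j with
  | zero =>
    intro i n s hs
    simpa using hbdd i n s hs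
  | succ j ih =>
    intro i n s hs
    have hs0 : 0 ≤ s := hs.1
    have hwin : 0 < w i n := hpos i n
    have hMΦ : 0 ≤ MΦ := (abs_nonneg _).trans (hΦ i n 0 ⟨le_rfl, hs0.trans hs.2⟩)
    have hA0 := tableAbsSum_nonneg 𝕊 α
    have hL0 : 0 ≤ L := by rw [hL]; positivity
    have hB0 : 0 ≤ B := le_trans (mul_nonneg hwin.le (abs_nonneg _)) (hB i n)
    have hMu : 0 ≤ Mu := (abs_nonneg _).trans (hbdd i n 0 ⟨le_rfl, hs0.trans hs.2⟩)
    set B' : ℝ := B / w i n with hB'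
    set F' : ℝ := F / w i n with hF'
    have hB'0 : 0 ≤ B' := by rw [hB']; positivity
    have hF'0 : 0 ≤ F' := by rw [hF']; positivity
    have hsub : Icc 0 s ⊆ Icc 0 T := Icc_subset_Icc_right hs.2
    have hLcs : ContinuousOn (fun t => linTermOn 𝕊 0 α Φ u i n t + f i n t) (uIcc 0 s) := by
      rw [uIcc_of_le hs0]; exact (hLc i n).mono hsub
    have hftc : ∫ σ in (0 : ℝ)..s, (linTermOn 𝕊 0 α Φ u i n σ + f i n σ) = u i n s - u i n 0 :=
      intervalIntegral.integral_eq_sub_of_hasDerivAt_of_le hs0 ((huc i n).mono hsub)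
        (fun σ hσ => hder i n σ ⟨hσ.1, hσ.2.trans_le hs.2⟩) hLcs.intervalIntegrable
    -- pointwise bound of the integrand on [0, s]
    have hpt : ∀ σ ∈ Icc 0 s, |linTermOn 𝕊 0 α Φ u i n σ + f i n σ| ≤
        F' + L * ((B' + F' * s) * ∑ l ∈ Finset.range j, (L * σ) ^ l / l ! + Mu * (L * σ) ^ j / j !) := by
      intro σ hσ
      have hσT : σ ∈ Icc 0 T := ⟨hσ.1, hσ.2.trans hs.2⟩
      have hsum0 : 0 ≤ ∑ l ∈ Finset.range j, (L * σ) ^ l / (l ! : ℝ) :=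
        Finset.sum_nonneg fun l _ => by have := hσ.1; positivity
      have hpow0 : 0 ≤ Mu * (L * σ) ^ j / j ! := by have := hσ.1; positivity
      set Wσ : ℝ := Λ * (B' + F' * s) * ∑ l ∈ Finset.range j, (L * σ) ^ l / l ! + Mu * (L * σ) ^ j / j ! with hWσ
      have hΛ0 : 0 ≤ Λ := le_trans zero_le_one hΛ
      have hWσ0 : 0 ≤ Wσ := by
        have h1 : 0 ≤ B' + F' * s := by positivity
        have h2 : 0 ≤ Λ * (B' + F' * s) * ∑ l ∈ Finset.range j, (L * σ) ^ l / (l ! : ℝ) :=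
          mul_nonneg (mul_nonneg hΛ0 h1) hsum0
        rw [hWσ]; linarith
      have hb : ∀ j' k, |windowFam n u j' k σ| ≤ Wσ := by
        intro j' k
        unfold windowFam
        split_ifs with hk
        · have hih := ih j' k σ hσT
          have hwjk : 0 < w j' k := hpos j' k
          have hcoef : B / w j' k + F / w j' k * σ ≤ Λ * (B' + F' * s) := by
            have e1 : B / w j' k + F / w j' k * σ = (B + F * σ) / w j' k := by
              rw [add_div, mul_div_right_comm]
            have e2 : Λ * (B' + F' * s) = Λ * (B + F * s) / w i n := by
              rw [hB', hF']; field_simp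
            rw [e1, e2, div_le_div_iff₀ hwjk hwin]
            have hBs : B + F * σ ≤ B + F * s := by nlinarith [hσ.2]
            have hBs0 : 0 ≤ B + F * s := by positivity
            calc (B + F * σ) * w i n ≤ (B + F * s) * (Λ * w j' k) :=
                  mul_le_mul hBs (hw.2.2 i j' n k hk) hwin.le hBs0
              _ = Λ * (B + F * s) * w j' k := by ring
          calc |u j' k σ| ≤ (B / w j' k + F / w j' k * σ) * ∑ l ∈ Finset.range j, (L * σ) ^ l / l ! +
                Mu * (L * σ) ^ j / j ! := hih
            _ ≤ Λ * (B' + F' * s) * ∑ l ∈ Finset.range j, (L * σ) ^ l / l ! + Mu * (L * σ) ^ j / j ! := by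
                have := mul_le_mul_of_nonneg_right hcoef hsum0
                linarith
        · rw [abs_zero]; exact hWσ0
      have hlin : |linTermOn 𝕊 0 α Φ u i n σ| ≤ 2 * tableAbsSum 𝕊 α * MΦ * Wσ := by
        rw [← linTermOn_windowFam h𝕊 0 α Φ u i n σ]
        exact abs_linTermOn_zero_le 𝕊 α (fun j' k => hΦ j' k σ hσT) hb i n
      have hlin' : 2 * tableAbsSum 𝕊 α * MΦ * Wσ ≤
          L * ((B' + F' * s) * ∑ l ∈ Finset.range j, (L * σ) ^ l / l ! + Mu * (L * σ) ^ j / j !) := by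
        rw [hWσ, hL]
        have h1 : 2 * tableAbsSum 𝕊 α * MΦ * (Mu * (2 * tableAbsSum 𝕊 α * MΦ * Λ * σ) ^ j / ↑j !) ≤
            2 * tableAbsSum 𝕊 α * MΦ * Λ * (Mu * (2 * tableAbsSum 𝕊 α * MΦ * Λ * σ) ^ j / ↑j !) := by
          have h0 : 0 ≤ 2 * tableAbsSum 𝕊 α * MΦ * (Mu * (2 * tableAbsSum 𝕊 α * MΦ * Λ * σ) ^ j / ↑j !) := by
            rw [← hL]; positivity
          nlinarith
        rw [← hL] at h1 ⊢
        nlinarith [h1]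
      have hf' : |f i n σ| ≤ F' := by
        rw [hF', le_div_iff₀ hwin, mul_comm]; exact hf i n σ hσT
      calc |linTermOn 𝕊 0 α Φ u i n σ + f i n σ|
          ≤ |linTermOn 𝕊 0 α Φ u i n σ| + |f i n σ| := abs_add_le _ _
        _ ≤ L * ((B' + F' * s) * ∑ l ∈ Finset.range j, (L * σ) ^ l / l ! + Mu * (L * σ) ^ j / j !) + F' :=
            add_le_add (hlin.trans hlin') hf'
        _ = F' + L * ((B' + F' * s) * ∑ l ∈ Finset.range j, (L * σ) ^ l / l ! + Mu * (L * σ) ^ j / j !) := by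
            ring
    have hmaj2 : Continuous fun σ : ℝ =>
        L * ((B' + F' * s) * ∑ l ∈ Finset.range j, (L * σ) ^ l / l ! + Mu * (L * σ) ^ j / j !) := by
      refine continuous_const.mul (Continuous.add ?_ ?_)
      · exact continuous_const.mul (continuous_finsetSum _ fun l _ =>
          ((continuous_const.mul continuous_id).pow l).div_const _)
      · exact (continuous_const.mul ((continuous_const.mul continuous_id).pow j)).div_const _
    have hmaj_cont : Continuous fun σ : ℝ =>
        F' + L * ((B' + F' * s) * ∑ l ∈ Finset.range j, (L * σ) ^ l / l ! + Mu * (L * σ) ^ j / j !) :=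
      continuous_const.add hmaj2
    have hI : ∫ σ in (0 : ℝ)..s,
        (F' + L * ((B' + F' * s) * ∑ l ∈ Finset.range j, (L * σ) ^ l / l ! + Mu * (L * σ) ^ j / j !)) =
        F' * s + ((B' + F' * s) * ∑ l ∈ Finset.range j, (L * s) ^ (l + 1) / (l + 1)! +
          Mu * (L * s) ^ (j + 1) / (j + 1)!) := by
      rw [intervalIntegral.integral_add intervalIntegrable_const (hmaj2.intervalIntegrable _ _),
        intervalIntegral.integral_const, integral_majorant, smul_eq_mul, sub_zero, mul_comm s F']
    have hu_eq : u i n s = u i n 0 + ∫ σ in (0 : ℝ)..s, (linTermOn 𝕊 0 α Φ u i n σ + f i n σ) := by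
      rw [hftc]; ring
    have hB'' : |u i n 0| ≤ B' := by
      rw [hB', le_div_iff₀ hwin, mul_comm]; exact hB i n
    calc |u i n s| = |u i n 0 + ∫ σ in (0 : ℝ)..s, (linTermOn 𝕊 0 α Φ u i n σ + f i n σ)| := by rw [← hu_eq]
      _ ≤ |u i n 0| + |∫ σ in (0 : ℝ)..s, (linTermOn 𝕊 0 α Φ u i n σ + f i n σ)| := abs_add_le _ _
      _ ≤ B' + ∫ σ in (0 : ℝ)..s, |linTermOn 𝕊 0 α Φ u i n σ + f i n σ| :=
          add_le_add hB'' (intervalIntegral.abs_integral_le_integral_abs hs0)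
      _ ≤ B' + ∫ σ in (0 : ℝ)..s,
            (F' + L * ((B' + F' * s) * ∑ l ∈ Finset.range j, (L * σ) ^ l / l ! + Mu * (L * σ) ^ j / j !)) := by
          gcongr
          exact intervalIntegral.integral_mono_on hs0 (hLcs.norm.intervalIntegrable)
            (hmaj_cont.intervalIntegrable _ _) hpt
      _ = B' + (F' * s + ((B' + F' * s) * ∑ l ∈ Finset.range j, (L * s) ^ (l + 1) / (l + 1)! +
            Mu * (L * s) ^ (j + 1) / (j + 1)!)) := by rw [hI]
      _ = (B' + F' * s) * ∑ l ∈ Finset.range (j + 1), (L * s) ^ l / l ! + Mu * (L * s) ^ (j + 1) / (j + 1)! := by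
          rw [Finset.sum_range_succ' (fun l => (L * s) ^ l / (l ! : ℝ))]
          simp only [pow_zero, Nat.factorial_zero, Nat.cast_one, div_one]
          ring

/-- **GAUGE DUHAMEL–GRONWALL ON A WINDOW**: under the hypotheses of `gauge_abs_le_forced_majorant_Icc`,
`w_{i,n}|u_{i,n}(s)| ≤ (B + F s)·exp(2‖α‖₁M_ΦΛ s)` on `[0, T]`. [cite: Tao2016AveragedNS, §4 (4.8); folklore (Gronwall)] -/
theorem gauge_abs_le_forced_exp_Icc {𝕊 : Finset (ℤ × ℤ × ℤ)} (h𝕊 : IsNearestNeighbourSet 𝕊)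
    (α : Fin m → Fin m → Fin m → ℤ × ℤ × ℤ → ℝ) {w : Fin m → ℤ → ℝ} {Λ : ℝ} (hw : IsWindowRegular w Λ)
    {Φ u f : Fin m → ℤ → ℝ → ℝ} {MΦ Mu B F T : ℝ} (hΦc : ∀ j k, ContinuousOn (Φ j k) (Icc 0 T))
    (hΦ : ∀ j k, ∀ t ∈ Icc 0 T, |Φ j k t| ≤ MΦ) (hfc : ∀ j k, ContinuousOn (f j k) (Icc 0 T))
    (hf : ∀ j k, ∀ t ∈ Icc 0 T, w j k * |f j k t| ≤ F) (hF : 0 ≤ F) (huc : ∀ i n, ContinuousOn (u i n) (Icc 0 T))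
    (hder : ∀ i n, ∀ t ∈ Ioo 0 T, HasDerivAt (u i n) (linTermOn 𝕊 0 α Φ u i n t + f i n t) t)
    (hbdd : ∀ i n, ∀ t ∈ Icc 0 T, |u i n t| ≤ Mu) (hB : ∀ i n, w i n * |u i n 0| ≤ B) (i : Fin m) (n : ℤ)
    {s : ℝ} (hs : s ∈ Icc 0 T) : w i n * |u i n s| ≤ (B + F * s) * Real.exp (2 * tableAbsSum 𝕊 α * MΦ * Λ * s) := by
  have hwin : 0 < w i n := hw.1 i n
  set x := 2 * tableAbsSum 𝕊 α * MΦ * Λ * s with hx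
  have hMΦ : 0 ≤ MΦ := (abs_nonneg _).trans (hΦ i n 0 ⟨le_rfl, hs.1.trans hs.2⟩)
  have hΛ : 0 ≤ Λ := le_trans zero_le_one hw.2.1
  have hx0 : 0 ≤ x := by rw [hx]; have := tableAbsSum_nonneg 𝕊 α; have := hs.1; positivity
  have hB0 : 0 ≤ B := le_trans (mul_nonneg hwin.le (abs_nonneg _)) (hB i n)
  have hB'0 : 0 ≤ B / w i n + F / w i n * s := by have := hs.1; positivity
  have hmaj : ∀ j : ℕ, |u i n s| ≤ (B / w i n + F / w i n * s) * Real.exp x + Mu * x ^ j / j ! := by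
    intro j
    have h := gauge_abs_le_forced_majorant_Icc h𝕊 α hw hΦc hΦ hfc hf hF huc hder hbdd hB j i n s hs
    have hsum : (B / w i n + F / w i n * s) * ∑ l ∈ Finset.range j, x ^ l / l ! ≤
        (B / w i n + F / w i n * s) * Real.exp x :=
      mul_le_mul_of_nonneg_left (Real.sum_le_exp_of_nonneg hx0 j) hB'0
    rw [← hx] at h
    linarith
  have hlim : Tendsto (fun j : ℕ => (B / w i n + F / w i n * s) * Real.exp x + Mu * x ^ j / j !) atTop
      (𝓝 ((B / w i n + F / w i n * s) * Real.exp x)) := by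
    have h := (Real.summable_pow_div_factorial x).tendsto_atTop_zero
    have h2 := (h.const_mul Mu).const_add ((B / w i n + F / w i n * s) * Real.exp x)
    rw [mul_zero, add_zero] at h2
    refine h2.congr fun j => ?_
    ring
  have hle : |u i n s| ≤ (B / w i n + F / w i n * s) * Real.exp x := ge_of_tendsto' hlim hmaj
  have e : w i n * ((B / w i n + F / w i n * s) * Real.exp x) = (B + F * s) * Real.exp x := by
    field_simp
  calc w i n * |u i n s| ≤ w i n * ((B / w i n + F / w i n * s) * Real.exp x) :=
        mul_le_mul_of_nonneg_left hle hwin.le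
    _ = (B + F * s) * Real.exp x := e

/-- **Gauge Gronwall on a window, unforced.** [cite: Tao2016AveragedNS, §4 (4.8); folklore (Gronwall)] -/
theorem gauge_abs_le_exp_Icc {𝕊 : Finset (ℤ × ℤ × ℤ)} (h𝕊 : IsNearestNeighbourSet 𝕊)
    (α : Fin m → Fin m → Fin m → ℤ × ℤ × ℤ → ℝ) {w : Fin m → ℤ → ℝ} {Λ : ℝ} (hw : IsWindowRegular w Λ)
    {Φ u : Fin m → ℤ → ℝ → ℝ} {MΦ Mu B T : ℝ} (hΦc : ∀ j k, ContinuousOn (Φ j k) (Icc 0 T))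
    (hΦ : ∀ j k, ∀ t ∈ Icc 0 T, |Φ j k t| ≤ MΦ) (huc : ∀ i n, ContinuousOn (u i n) (Icc 0 T))
    (hder : ∀ i n, ∀ t ∈ Ioo 0 T, HasDerivAt (u i n) (linTermOn 𝕊 0 α Φ u i n t) t)
    (hbdd : ∀ i n, ∀ t ∈ Icc 0 T, |u i n t| ≤ Mu) (hB : ∀ i n, w i n * |u i n 0| ≤ B) (i : Fin m) (n : ℤ)
    {s : ℝ} (hs : s ∈ Icc 0 T) : w i n * |u i n s| ≤ B * Real.exp (2 * tableAbsSum 𝕊 α * MΦ * Λ * s) := by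
  have h := gauge_abs_le_forced_exp_Icc h𝕊 α hw (f := fun _ _ _ => 0) (F := 0) hΦc hΦ
    (fun _ _ => continuousOn_const) (fun j k t _ => by simp) le_rfl huc
    (fun i n t ht => by simpa using hder i n t ht) hbdd hB i n hs
  simpa using h

/-- **GAUGE CONTINUITY IN THE DATA ON A WINDOW**: two solutions of the ratio-`1` lattice on `[0, T]` (continuous on the
window, `HasDerivAt` inside, both bounded by `M` there) with `w|X(0) − W(0)| ≤ B` satisfy
`w_{i,n}|X_{i,n}(s) − W_{i,n}(s)| ≤ B·exp(2‖α‖₁MΛ s)` on `[0, T]`. [cite: Tao2016AveragedNS, §4 (4.8); folklore (Gronwall)] -/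
theorem gauge_abs_sub_le_Icc {𝕊 : Finset (ℤ × ℤ × ℤ)} (h𝕊 : IsNearestNeighbourSet 𝕊)
    (α : Fin m → Fin m → Fin m → ℤ × ℤ × ℤ → ℝ) {w : Fin m → ℤ → ℝ} {Λ : ℝ} (hw : IsWindowRegular w Λ)
    {X W : Fin m → ℤ → ℝ → ℝ} {M B T : ℝ}
    (hXc : ∀ i n, ContinuousOn (X i n) (Icc 0 T)) (hWc : ∀ i n, ContinuousOn (W i n) (Icc 0 T))
    (hX : ∀ i n, ∀ t ∈ Ioo 0 T, HasDerivAt (X i n) (quadTermOn 𝕊 0 α X i n t) t)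
    (hW : ∀ i n, ∀ t ∈ Ioo 0 T, HasDerivAt (W i n) (quadTermOn 𝕊 0 α W i n t) t)
    (hXb : ∀ i n, ∀ t ∈ Icc 0 T, |X i n t| ≤ M) (hWb : ∀ i n, ∀ t ∈ Icc 0 T, |W i n t| ≤ M)
    (hB : ∀ i n, w i n * |X i n 0 - W i n 0| ≤ B) (i : Fin m) (n : ℤ) {s : ℝ} (hs : s ∈ Icc 0 T) :
    w i n * |X i n s - W i n s| ≤ B * Real.exp (2 * tableAbsSum 𝕊 α * M * Λ * s) := by
  set Ψ : Fin m → ℤ → ℝ → ℝ := (1 / 2 : ℝ) • (X + W) with hΨ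
  set η : Fin m → ℤ → ℝ → ℝ := X - W with hη
  have hΨc : ∀ j k, ContinuousOn (Ψ j k) (Icc 0 T) := fun j k => by
    show ContinuousOn (fun t => (1 / 2 : ℝ) * (X j k t + W j k t)) (Icc 0 T)
    exact continuousOn_const.mul ((hXc j k).add (hWc j k))
  have hηc : ∀ j k, ContinuousOn (η j k) (Icc 0 T) := fun j k => by
    show ContinuousOn (fun t => X j k t - W j k t) (Icc 0 T)
    exact (hXc j k).sub (hWc j k)
  have hΨb : ∀ j k, ∀ t ∈ Icc 0 T, |Ψ j k t| ≤ M := fun j k t ht => by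
    show |(1 / 2 : ℝ) * (X j k t + W j k t)| ≤ M
    rw [abs_mul, abs_of_pos (by norm_num : (0 : ℝ) < 1 / 2)]
    linarith [abs_add_le (X j k t) (W j k t), hXb j k t ht, hWb j k t ht]
  have hder : ∀ j k, ∀ t ∈ Ioo 0 T, HasDerivAt (η j k) (linTermOn 𝕊 0 α Ψ η j k t) t := fun j k t ht => by
    rw [hΨ, hη, ← quadTermOn_sub_eq_linTermOn_mid]
    exact (hX j k t ht).sub (hW j k t ht)
  have hηb : ∀ j k, ∀ t ∈ Icc 0 T, |η j k t| ≤ 2 * M := fun j k t ht => by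
    show |X j k t - W j k t| ≤ 2 * M
    linarith [abs_sub (X j k t) (W j k t), hXb j k t ht, hWb j k t ht]
  exact gauge_abs_le_exp_Icc h𝕊 α hw hΨc hΨb hηc hder hηb hB i n hs

end QuadPolar

/-! ### Exact `PseudoFlowOnShift` flows as window solutions -/

namespace QuadPolar

variable {m : ℕ}

/-- The amplitudes of a `PseudoFlowOnShift` flow are continuous on the window. [cite: Tao2016AveragedNS, §4 Lemma 4.1 (4.8); cell vocabulary] -/
theorem continuousOn_of_pseudoFlowOnShift {𝕊 : Finset (ℤ × ℤ × ℤ)} {τ ε₀ : ℝ}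
    {α : Fin m → Fin m → Fin m → ℤ × ℤ × ℤ → ℝ} {κ₁ κ₂ : ℝ} {S₀ F₀ B₀ : Fin m → ℤ → ℝ}
    {S F : Fin m → ℤ → ℝ → ℝ} (h : PseudoFlowOnShift 𝕊 τ ε₀ α κ₁ κ₂ S₀ F₀ B₀ S F) (i : Fin m) (k : ℤ) :
    ContinuousOn (S i k) (Icc 0 τ) :=
  (h.contDiffOn_S i k).continuousOn

/-- **An EXACT (`κ₁ = 0`) `PseudoFlowOnShift` flow solves the lattice with `HasDerivAt` at every interior time**:
`HasDerivAt (S i k) (quadTermOn 𝕊 ε₀ α S i k s) s` for `s ∈ Ioo 0 τ`.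
[cite: Tao2016AveragedNS, §4 Lemma 4.1 (4.8); cell vocabulary, shift-set parametrised] -/
theorem hasDerivAt_of_pseudoFlowOnShift_exact {𝕊 : Finset (ℤ × ℤ × ℤ)} {τ ε₀ : ℝ}
    {α : Fin m → Fin m → Fin m → ℤ × ℤ × ℤ → ℝ} {κ₂ : ℝ} {S₀ F₀ B₀ : Fin m → ℤ → ℝ}
    {S F : Fin m → ℤ → ℝ → ℝ} (h : PseudoFlowOnShift 𝕊 τ ε₀ α 0 κ₂ S₀ F₀ B₀ S F) (i : Fin m) (k : ℤ) {s : ℝ}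
    (hs : s ∈ Ioo 0 τ) : HasDerivAt (S i k) (quadTermOn 𝕊 ε₀ α S i k s) s := by
  have hsI : s ∈ Icc 0 τ := ⟨hs.1.le, hs.2.le⟩
  have hmot := h.motion i k s hsI
  rw [zero_mul, zero_mul] at hmot
  have heq : derivWithin (S i k) (Icc 0 τ) s = quadTermOn 𝕊 ε₀ α S i k s := by
    have := abs_nonpos_iff.mp hmot
    linarith
  have hnhds : Icc 0 τ ∈ 𝓝 s := Icc_mem_nhds hs.1 hs.2
  have hdiff : DifferentiableAt ℝ (S i k) s :=
    ((h.contDiffOn_S i k).differentiableOn (by norm_num) s hsI).differentiableAt hnhds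
  have hd : HasDerivAt (S i k) (deriv (S i k) s) s := hdiff.hasDerivAt
  rwa [← derivWithin_of_mem_nhds hnhds, heq] at hd

end QuadPolar

end Summit.NavierStokesRegularity.NavierStokesRegularity.Theorems

end
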